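import Mathlib
import Summits.Ventures.HodgeRepro2.Tier7.Line3.FinKappaOfLocalSplit
import Summits.Ventures.HodgeRepro2.Tier7.Line3.AdicCompletionLevel
import Summits.Ventures.HodgeRepro2.Tier7.Line3.AdicCompletionRestriction
import Summits.Ventures.HodgeRepro2.Tier7.Line3.JointSupport

/-!
# Tier7/Line3/AdicCompletionSplit — the κ-side split-place data at the real completion
(seat t7-x1, gen 5; the split-place twin of AdicCompletionRestriction p706703: KappaDataFinLocalSplit's local-field
hypotheses discharged on Mathlib's completion of the BASE field)

LINE 3 (t7-plan-3), version (ii). At a place `v` of `K = E⁺` SPLIT in `E`, the local algebra `E ⊗_K K_v ≅ K_v × K_v` is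
not a field: L1-p5's KappaDataFinLocalSplit (p687119) reads κ through TWO conjugate embeddings `ψ₁, ψ₂ = ψ₁ ∘ σ` of `E`
into ONE abstract field `Kw` with an absolute value `abv` restricting to `|·|_v` on `K` (`hψ`, `hw`, `hna` displayed), and
FinKappaOfLocalSplit (p688742) packages them per place as `SplitLocal` (`Kw : FinitePlace K → Type` a parameter). This
module discharges the local-field hypotheses on Mathlib's completion `v.adicCompletion K` of the BASE field:

* the datum is ONE ring homomorphism `ψ₁ : E →+* v.adicCompletion K` extending the canonical embedding of `K`
  (`hψ₁ : ψ₁ (algebraMap K E x) = FinitePlace.embedding v x` — its existence IS «`v` splits in `E`», the dictionary);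
  `secondEmbedding σ ψ₁ := ψ₁.comp σ` is the conjugate one, so `hψ` holds by definition;
* `finitePlace_eq_normAbv : FinitePlace.mk v x = normAbv (ψ₁ (algebraMap K E x))` (`hw`, from `FinitePlace.mk_apply`),
  `hna := isNonarchimedean_normAbv` (IsUltrametricDist on the completion, AdicCompletionLocalField p703140) — at a
  split place there is NO root to take: `e = f = 1`, the κ-side absolute value IS Mathlib's normalised norm, the κ-side
  `q` IS `q v` (contrast the non-split `abvRoot = ‖·‖^{1/(ef)}`, `qκ = (q wE)^{1/(ef)}` of p706703 / p713992);
* THE CONSUMERS `hout_field_local_split_adic` / `hS_field_local_split_adic` / `hcong_field_local_split_adic` =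
  KappaDataFinLocalSplit's three theorems at `(Kw, abv, ψ₂) := (v.adicCompletion K, normAbv, ψ₁.comp σ)` with
  `hψ / hw / hna` GONE, and `hcong_field_local_split_adic_of_levelTower`: the two components' level clauses stated
  against the `b`-side tower's radius `(q v)⁻¹ ^ (N+1)` (AdicCompletionLevel p705534: the tower at `q := q v` is the
  principal congruence tower of `GL₂(K_v)`), conclusion `FinitePlace.mk v (κF γ − κF γ₀) ≤ (q v)⁻¹ ^ N` — the `N+1`
  vs `N` shift absorbed as in LevelKappaConversion;
* `SplitLocal.ofAdicCompletion` (shape (β) of crit-2 STATUS l. 16170 (C1) / plan-3 l. 16173): the per-place package of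
  FinKappaOfLocalSplit built on `Ew w := (wE w).adicCompletion E` for a CHOSEN prime `wE w` above each `w` — a total
  family, as L1-p5's binder `ψ₁ : ∀ w, E →+* Kw w` demands (no ring hom `E →+* K_w` exists at an inert `w`, so the base
  completion cannot carry the total family) — with `ψ₁ w := FinitePlace.embedding (wE w)`, `ψ₂ w := (ψ₁ w).comp σ`,
  `abv w := normAbv`; `hψ` / `hna` are theorems and `habv` is one from the DISPLAYED local-degree datum
  `hsplit : ∀ w ∈ Sp, localDeg (maximalIdeal w) (wE w) = 1` (`apply_eq_normAbv_of_localDeg_eq_one`); every other field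
  is passed through DISPLAYED; so L1-p5's `SplitLocal.hout_split` / `hS_split` consume it by name.

WHAT THIS CHANGES IN THE [W] COLUMN: «the choice of `ψ₁ w`, `ψ₂ w`, `abv w` above a split `w` (the dictionary)»
(FinKappaOfLocalSplit's docstring) → Mathlib's completion of the base field with its normalised norm and ONE displayed
splitting homomorphism per split place (section `place`), resp. the completion of `E` at a chosen prime above each
place with the local-degree datum `e f = 1` at the split places (section `package`); the κ-side level at a split
place is read off the same tower as the `b`-side with `q := q v` (no root). STILL IN WORDS: that the real `v` splits
in `E` (the existence of `ψ₁`, resp. `e f = 1` at `wE w / w`), WHICH prime above `w` is `wE w` (a choice), that the real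
`K_w` at a split `w` IS the pair of integral matrices in the adapted coordinates of the two components, the
identification (a′). Nothing here is about (N), (P), the real `X`, or HC_CM; §8(d): NO. Blind lane: Mathlib + the HodgeRepro2 prefix;
no sorry; axioms ⊆ {propext, Classical.choice, Quot.sound}.
-/

namespace Summit.Ventures.HodgeRepro2.Tier7.Line3.AdicCompletionSplit

open IsDedekindDomain IsDedekindDomain.HeightOneSpectrum NumberField Matrix
  Summit.Ventures.HodgeRepro2.Tier7.Line3.LevelTowerTopology
  Summit.Ventures.HodgeRepro2.Tier7.Line3.CongruenceSubgroup
  Summit.Ventures.HodgeRepro2.Tier7.Line3.AdicCompletionLevel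
  Summit.Ventures.HodgeRepro2.Tier7.Line3.AdicCompletionRestriction
  Summit.Ventures.HodgeRepro2.Tier7.Line3.KappaDataFinLocalSplit
  Summit.Ventures.HodgeRepro2.Tier7.Line3.JointSupport
  Summit.Ventures.HodgeRepro2.T7SupportTwoTorusInvariant
open scoped NumberField

/-! ## The splitting datum at one place -/

section place

variable {K E : Type*} [Field K] [NumberField K] [Field E] [Algebra K E]
  (v : HeightOneSpectrum (𝓞 K)) (σ : E →+* E) (ψ₁ : E →+* v.adicCompletion K)

/-- **the conjugate embedding** `ψ₂ := ψ₁ ∘ σ` — at a split `v` this IS the other `K`-embedding of `E` into `K_v`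
(`ψ₁ ∘ σ ≠ ψ₁` for `σ ≠ id`, a ring hom out of a field being injective; crit-2 STATUS l. 16170 (ii)). -/
noncomputable def secondEmbedding : E →+* v.adicCompletion K := ψ₁.comp σ

omit [Algebra K E] in
/-- `ψ₂ x = ψ₁ (σ x)` — KappaDataFinLocalSplit's `hψ`, by definition. -/
theorem secondEmbedding_apply (x : E) : secondEmbedding v σ ψ₁ x = ψ₁ (σ x) := rfl

/-- **the restriction law at a split place**: `ψ₁` extending the canonical embedding of `K` gives
`FinitePlace.mk v x = ‖ψ₁ (algebraMap K E x)‖` — KappaDataFinLocalSplit's `hw` with `abv := normAbv`. -/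
theorem finitePlace_eq_normAbv (hψ₁ : ∀ x : K, ψ₁ (algebraMap K E x) = FinitePlace.embedding v x) (x : K) :
    FinitePlace.mk v x = normAbv (ψ₁ (algebraMap K E x)) := by
  rw [hψ₁, FinitePlace.mk_apply, normAbv_apply]

variable (d : Fin 2 → E) (f : Fin 2 → Fin 2 → E) {Orb : Type*} (matO : Orb → Matrix (Fin 2) (Fin 2) E)
  (κF : Orb → K) (arith : ℕ → Orb → Prop) (γ₀ : Orb)

/-- **`hout` at a split place of the real completion** (KappaDataFinLocalSplit.hout_field_local_split at
`v.adicCompletion K`, `hψ / hw / hna` discharged). -/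
theorem hout_field_local_split_adic
    (hψ₁ : ∀ x : K, ψ₁ (algebraMap K E x) = FinitePlace.embedding v x)
    (hκ : ∀ γ, algebraMap K E (κF γ) = kappa σ d f (matO γ))
    (hf₁ : ∀ i, normAbv (ψ₁ (f 0 i)) ≤ 1) (hf₂ : ∀ i, normAbv (secondEmbedding v σ ψ₁ (f 0 i)) ≤ 1)
    (hd₁ : normAbv (ψ₁ (d 0)) ≤ 1) (hd₂ : normAbv (secondEmbedding v σ ψ₁ (d 0)) ≤ 1)
    (hdisc : normAbv (ψ₁ (d 0) *
      discSplit (fun i => ψ₁ (d i)) (fun j i => ψ₁ (f j i)) (fun j i => secondEmbedding v σ ψ₁ (f j i)) 0) = 1)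
    (hγ₀ : ∃ m₁ m₂, IsTranslateSplit (fun j i => ψ₁ (f j i)) (fun j i => secondEmbedding v σ ψ₁ (f j i))
      ((matO γ₀).map ψ₁) ((matO γ₀).map (secondEmbedding v σ ψ₁)) m₁ m₂ ∧
      (∀ i j, normAbv (m₁ i j) ≤ 1) ∧ ∀ i j, normAbv (m₂ i j) ≤ 1)
    (hsupp : ∀ N γ, arith N γ → ∃ m₁ m₂,
      IsTranslateSplit (fun j i => ψ₁ (f j i)) (fun j i => secondEmbedding v σ ψ₁ (f j i))
        ((matO γ).map ψ₁) ((matO γ).map (secondEmbedding v σ ψ₁)) m₁ m₂ ∧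
      (∀ i j, normAbv (m₁ i j) ≤ 1) ∧ ∀ i j, normAbv (m₂ i j) ≤ 1) :
    ∀ N γ, arith N γ → FinitePlace.mk v (κF γ - κF γ₀) ≤ 1 :=
  hout_field_local_split normAbv σ ψ₁ (secondEmbedding v σ ψ₁) d f matO κF (FinitePlace.mk v) arith γ₀
    (secondEmbedding_apply v σ ψ₁) (finitePlace_eq_normAbv v ψ₁ hψ₁) hκ isNonarchimedean_normAbv hf₁ hf₂ hd₁ hd₂
    hdisc hγ₀ hsupp

/-- **`hS` at a split place of the real completion** (KappaDataFinLocalSplit.hS_field_local_split, `hψ / hw / hna`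
discharged). -/
theorem hS_field_local_split_adic
    (hψ₁ : ∀ x : K, ψ₁ (algebraMap K E x) = FinitePlace.embedding v x)
    (hκ : ∀ γ, algebraMap K E (κF γ) = kappa σ d f (matO γ))
    {M : ℝ} (hM : 0 ≤ M) (hf₁ : ∀ i, normAbv (ψ₁ (f 0 i)) ≤ M)
    (hf₂ : ∀ i, normAbv (secondEmbedding v σ ψ₁ (f 0 i)) ≤ M)
    (hd₁ : normAbv (ψ₁ (d 0)) ≤ M) (hd₂ : normAbv (secondEmbedding v σ ψ₁ (d 0)) ≤ M)
    (hγ₀ : ∃ m₁ m₂, IsTranslateSplit (fun j i => ψ₁ (f j i)) (fun j i => secondEmbedding v σ ψ₁ (f j i))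
      ((matO γ₀).map ψ₁) ((matO γ₀).map (secondEmbedding v σ ψ₁)) m₁ m₂ ∧
      (∀ i j, normAbv (m₁ i j) ≤ M) ∧ ∀ i j, normAbv (m₂ i j) ≤ M)
    (hsupp : ∀ N γ, arith N γ → ∃ m₁ m₂,
      IsTranslateSplit (fun j i => ψ₁ (f j i)) (fun j i => secondEmbedding v σ ψ₁ (f j i))
        ((matO γ).map ψ₁) ((matO γ).map (secondEmbedding v σ ψ₁)) m₁ m₂ ∧
      (∀ i j, normAbv (m₁ i j) ≤ M) ∧ ∀ i j, normAbv (m₂ i j) ≤ M) :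
    ∀ N γ, arith N γ → FinitePlace.mk v (κF γ - κF γ₀) ≤
      M ^ 6 / normAbv (ψ₁ (d 0) *
        discSplit (fun i => ψ₁ (d i)) (fun j i => ψ₁ (f j i)) (fun j i => secondEmbedding v σ ψ₁ (f j i)) 0) :=
  hS_field_local_split normAbv σ ψ₁ (secondEmbedding v σ ψ₁) d f matO κF (FinitePlace.mk v) arith γ₀
    (secondEmbedding_apply v σ ψ₁) (finitePlace_eq_normAbv v ψ₁ hψ₁) hκ isNonarchimedean_normAbv hM hf₁ hf₂ hd₁
    hd₂ hγ₀ hsupp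

/-- **`hcong` at a split place of the real completion** (KappaDataFinLocalSplit.hcong_field_local_split,
`hψ / hw / hna` discharged; the level base `q` still free). -/
theorem hcong_field_local_split_adic
    (hψ₁ : ∀ x : K, ψ₁ (algebraMap K E x) = FinitePlace.embedding v x)
    (hκ : ∀ γ, algebraMap K E (κF γ) = kappa σ d f (matO γ))
    (hf₁ : ∀ i, normAbv (ψ₁ (f 0 i)) ≤ 1) (hf₂ : ∀ i, normAbv (secondEmbedding v σ ψ₁ (f 0 i)) ≤ 1)
    (hd₁ : normAbv (ψ₁ (d 0)) ≤ 1) (hd₂ : normAbv (secondEmbedding v σ ψ₁ (d 0)) ≤ 1)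
    (hdisc : normAbv (ψ₁ (d 0) *
      discSplit (fun i => ψ₁ (d i)) (fun j i => ψ₁ (f j i)) (fun j i => secondEmbedding v σ ψ₁ (f j i)) 0) = 1)
    {q : ℝ} (hq : 1 < q) (γ₀w γ₀w' : Matrix (Fin 2) (Fin 2) (v.adicCompletion K))
    (hγ₀ : IsTranslateSplit (fun j i => ψ₁ (f j i)) (fun j i => secondEmbedding v σ ψ₁ (f j i))
      ((matO γ₀).map ψ₁) ((matO γ₀).map (secondEmbedding v σ ψ₁)) γ₀w γ₀w')
    (hγ₀int : ∀ i j, normAbv (γ₀w i j) ≤ 1) (hγ₀int' : ∀ i j, normAbv (γ₀w' i j) ≤ 1)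
    (hsupp : ∀ N γ, arith N γ → ∃ k₁ k₂ : Matrix (Fin 2) (Fin 2) (v.adicCompletion K),
      IsTranslateSplit (fun j i => ψ₁ (f j i)) (fun j i => secondEmbedding v σ ψ₁ (f j i))
        ((matO γ).map ψ₁) ((matO γ).map (secondEmbedding v σ ψ₁)) (γ₀w * k₁) (γ₀w' * k₂) ∧
      (∀ i j, normAbv ((k₁ - 1) i j) ≤ q⁻¹ ^ N) ∧ ∀ i j, normAbv ((k₂ - 1) i j) ≤ q⁻¹ ^ N) :
    ∀ N γ, arith N γ → FinitePlace.mk v (κF γ - κF γ₀) ≤ q⁻¹ ^ N :=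
  hcong_field_local_split normAbv σ ψ₁ (secondEmbedding v σ ψ₁) d f matO κF (FinitePlace.mk v) arith γ₀
    (secondEmbedding_apply v σ ψ₁) (finitePlace_eq_normAbv v ψ₁ hψ₁) hκ isNonarchimedean_normAbv hf₁ hf₂ hd₁ hd₂
    hdisc hq γ₀w γ₀w' hγ₀ hγ₀int hγ₀int' hsupp

/-- **`hcong` at a split place with the level read off the `b`-side tower**: the two components' level clauses at the
tower's radius `(q v)⁻¹ ^ (N+1)` (AdicCompletionLevel p705534: `levelTower normAbv _ (one_lt_q v) N` is the principal
congruence subgroup of level `𝔭_v^(N+1)` of `GL₂(K_v)`), conclusion `FinitePlace.mk v (κF γ − κF γ₀) ≤ (q v)⁻¹ ^ N`;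
the κ-side level base at a split place IS `q v` (no root: `e = f = 1`). The ONE drop of a power is here: the parent
`hcong_field_local_split` (p687119) takes `hsupp` at `q⁻¹ ^ N` in both components and concludes at `q⁻¹ ^ N` (no drop);
this consumer feeds it at `N` from the tower's radius `(q v)⁻¹ ^ (N+1)` through `JointSupport.radius_le` — no power is
claimed twice (crit-2 STATUS l. 16170 (i)). -/
theorem hcong_field_local_split_adic_of_levelTower
    (hψ₁ : ∀ x : K, ψ₁ (algebraMap K E x) = FinitePlace.embedding v x)
    (hκ : ∀ γ, algebraMap K E (κF γ) = kappa σ d f (matO γ))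
    (hf₁ : ∀ i, normAbv (ψ₁ (f 0 i)) ≤ 1) (hf₂ : ∀ i, normAbv (secondEmbedding v σ ψ₁ (f 0 i)) ≤ 1)
    (hd₁ : normAbv (ψ₁ (d 0)) ≤ 1) (hd₂ : normAbv (secondEmbedding v σ ψ₁ (d 0)) ≤ 1)
    (hdisc : normAbv (ψ₁ (d 0) *
      discSplit (fun i => ψ₁ (d i)) (fun j i => ψ₁ (f j i)) (fun j i => secondEmbedding v σ ψ₁ (f j i)) 0) = 1)
    (γ₀w γ₀w' : Matrix (Fin 2) (Fin 2) (v.adicCompletion K))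
    (hγ₀ : IsTranslateSplit (fun j i => ψ₁ (f j i)) (fun j i => secondEmbedding v σ ψ₁ (f j i))
      ((matO γ₀).map ψ₁) ((matO γ₀).map (secondEmbedding v σ ψ₁)) γ₀w γ₀w')
    (hγ₀int : ∀ i j, normAbv (γ₀w i j) ≤ 1) (hγ₀int' : ∀ i j, normAbv (γ₀w' i j) ≤ 1)
    (hsupp : ∀ N γ, arith N γ → ∃ k₁ k₂ : Matrix (Fin 2) (Fin 2) (v.adicCompletion K),
      IsTranslateSplit (fun j i => ψ₁ (f j i)) (fun j i => secondEmbedding v σ ψ₁ (f j i))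
        ((matO γ).map ψ₁) ((matO γ).map (secondEmbedding v σ ψ₁)) (γ₀w * k₁) (γ₀w' * k₂) ∧
      (∀ i j, ‖(k₁ - 1) i j‖ ≤ (q v)⁻¹ ^ (N + 1)) ∧ ∀ i j, ‖(k₂ - 1) i j‖ ≤ (q v)⁻¹ ^ (N + 1)) :
    ∀ N γ, arith N γ → FinitePlace.mk v (κF γ - κF γ₀) ≤ (q v)⁻¹ ^ N :=
  hcong_field_local_split_adic v σ ψ₁ d f matO κF arith γ₀ hψ₁ hκ hf₁ hf₂ hd₁ hd₂ hdisc (one_lt_q v) γ₀w γ₀w'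
    hγ₀ hγ₀int hγ₀int' fun N γ hγ => by
      obtain ⟨k₁, k₂, hk, hk₁, hk₂⟩ := hsupp N γ hγ
      exact ⟨k₁, k₂, hk, fun i j => (hk₁ i j).trans (radius_le (one_lt_q v) N),
        fun i j => (hk₂ i j).trans (radius_le (one_lt_q v) N)⟩

end place

/-! ## The per-place package of FinKappaOfLocalSplit on Mathlib's completions (shape (β): the completions of `E`) -/

section package

variable {E K Orb : Type} [Field E] [NumberField E] [Field K] [NumberField K] [Algebra K E] (σ : E →+* E)
  (wE : FinitePlace K → HeightOneSpectrum (𝓞 E))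
  (hlies : ∀ w, (wE w).asIdeal.LiesOver (FinitePlace.maximalIdeal w).asIdeal)

/-- **the completion-type family**: the completion of `E` at a CHOSEN prime `wE w` above each finite place `w` of `K`
(a total family — Mathlib's canonical embedding `E → E_{wE w}` exists at EVERY `w`, so L1-p5's total binder
`ψ₁ : ∀ w, E →+* Kw w` is met without a split / inert case split in the datum; crit-2 STATUS l. 16170 (C1), plan-3
l. 16173: shape (β)). -/
abbrev Ew (w : FinitePlace K) : Type := (wE w).adicCompletion E

include hlies in
/-- **the restriction law at a place of local degree one**: with `e f = 1` at `wE w / w` (a SPLIT `w`, `wE w` one of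
the primes above it), Mathlib's norm on `E_{wE w}` restricted to `K` IS the place `w`:
`w x = ‖embedding (wE w) (algebraMap K E x)‖` (`adicAbv_algebraMap` at `localDeg = 1`, `FinitePlace.mk_maximalIdeal`). -/
theorem apply_eq_normAbv_of_localDeg_eq_one (w : FinitePlace K)
    (hw : localDeg (FinitePlace.maximalIdeal w) (wE w) = 1) (x : K) :
    w x = normAbv (FinitePlace.embedding (wE w) (algebraMap K E x)) := by
  haveI := hlies w
  rw [normAbv_apply, FinitePlace.norm_embedding, adicAbv_algebraMap (FinitePlace.maximalIdeal w) (wE w) x, hw,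
    pow_one, ← FinitePlace.norm_embedding, ← FinitePlace.mk_apply, FinitePlace.mk_maximalIdeal]

variable (d : Fin 2 → E) (f : Fin 2 → Fin 2 → E) (matO : Orb → Matrix (Fin 2) (Fin 2) E) (κF : Orb → K)
  (arith : ℕ → Orb → Prop) (γ₀ : Orb) (S : Finset (FinitePlace K)) (Sp : Set (FinitePlace K))
  (M : FinitePlace K → ℝ)

/-- **`SplitLocal` on Mathlib's completions of `E` (shape (β))**: `Kw w := (wE w).adicCompletion E`,
`ψ₁ w := FinitePlace.embedding (wE w)` (the canonical embedding, at every `w`), `ψ₂ w := (ψ₁ w).comp σ`,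
`abv w := normAbv`; the fields `hψ` (by definition), `habv` (from the DISPLAYED local-degree datum
`hsplit : ∀ w ∈ Sp, localDeg (maximalIdeal w) (wE w) = 1` — «`w` splits and `wE w` is one of the two primes above it,
`e = f = 1`») and `hna` (ultrametricity of the completion, AdicCompletionLocalField p703140) are THEOREMS; every
other field (integrality / entry bounds / support clauses in the two components at the split places, `hMcomp`) is
passed through DISPLAYED, written with `FinitePlace.embedding (wE w)` and `σ`. NON-VACUITY (crit-2 STATUS l. 16170
(C1)): for `E = ℚ(i)`, `K = ℚ`, `Sp` = the primes `p ≡ 1 (mod 4)` and `wE p` one of the two primes above `p`, the datum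
`hsplit` holds (`e = f = 1` there); at an inert `w ∉ Sp` nothing is asserted — every `SplitLocal` field but the three
total homs is guarded by `w ∈ Sp`, and the canonical embedding exists at every `w`. At a split `w`, `E_{wE w}` IS `K_w`
as a valued field (`e = f = 1`; InertLevelBase.q_eq_pow_inertiaDeg at `f = 1`): the two embeddings `ψ₁ w`,
`ψ₂ w = ψ₁ w ∘ σ` are the two components, distinct for `σ ≠ id` (ring homs out of a field are injective). -/
noncomputable def SplitLocal.ofAdicCompletion
    (hκF : ∀ γ, algebraMap K E (κF γ) = kappa σ d f (matO γ))
    (hsplit : ∀ w ∈ Sp, localDeg (FinitePlace.maximalIdeal w) (wE w) = 1)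
    (hf₁_int : ∀ w ∈ Sp, w ∉ S → ∀ i, normAbv (FinitePlace.embedding (wE w) (f 0 i)) ≤ 1)
    (hf₂_int : ∀ w ∈ Sp, w ∉ S → ∀ i, normAbv (FinitePlace.embedding (wE w) (σ (f 0 i))) ≤ 1)
    (hd₁_int : ∀ w ∈ Sp, w ∉ S → normAbv (FinitePlace.embedding (wE w) (d 0)) ≤ 1)
    (hd₂_int : ∀ w ∈ Sp, w ∉ S → normAbv (FinitePlace.embedding (wE w) (σ (d 0))) ≤ 1)
    (hdisc_unit : ∀ w ∈ Sp, w ∉ S → normAbv (FinitePlace.embedding (wE w) (d 0) *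
      discSplit (fun i => FinitePlace.embedding (wE w) (d i)) (fun j i => FinitePlace.embedding (wE w) (f j i))
        (fun j i => FinitePlace.embedding (wE w) (σ (f j i))) 0) = 1)
    (hγ₀_int : ∀ w ∈ Sp, w ∉ S → ∃ m₁ m₂, IsTranslateSplit (fun j i => FinitePlace.embedding (wE w) (f j i))
      (fun j i => FinitePlace.embedding (wE w) (σ (f j i)))
      ((matO γ₀).map (FinitePlace.embedding (wE w))) ((matO γ₀).map ((FinitePlace.embedding (wE w)).comp σ)) m₁ m₂ ∧
      (∀ i j, normAbv (m₁ i j) ≤ 1) ∧ ∀ i j, normAbv (m₂ i j) ≤ 1)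
    (hsupp_int : ∀ w ∈ Sp, w ∉ S → ∀ N γ, arith N γ → ∃ m₁ m₂,
      IsTranslateSplit (fun j i => FinitePlace.embedding (wE w) (f j i))
        (fun j i => FinitePlace.embedding (wE w) (σ (f j i)))
        ((matO γ).map (FinitePlace.embedding (wE w))) ((matO γ).map ((FinitePlace.embedding (wE w)).comp σ)) m₁ m₂ ∧
      (∀ i j, normAbv (m₁ i j) ≤ 1) ∧ ∀ i j, normAbv (m₂ i j) ≤ 1)
    (Ms : FinitePlace K → ℝ) (hMs : ∀ w ∈ S, w ∈ Sp → 0 ≤ Ms w)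
    (hf₁_S : ∀ w ∈ S, w ∈ Sp → ∀ i, normAbv (FinitePlace.embedding (wE w) (f 0 i)) ≤ Ms w)
    (hf₂_S : ∀ w ∈ S, w ∈ Sp → ∀ i, normAbv (FinitePlace.embedding (wE w) (σ (f 0 i))) ≤ Ms w)
    (hd₁_S : ∀ w ∈ S, w ∈ Sp → normAbv (FinitePlace.embedding (wE w) (d 0)) ≤ Ms w)
    (hd₂_S : ∀ w ∈ S, w ∈ Sp → normAbv (FinitePlace.embedding (wE w) (σ (d 0))) ≤ Ms w)
    (hγ₀_S : ∀ w ∈ S, w ∈ Sp → ∃ m₁ m₂, IsTranslateSplit (fun j i => FinitePlace.embedding (wE w) (f j i))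
      (fun j i => FinitePlace.embedding (wE w) (σ (f j i)))
      ((matO γ₀).map (FinitePlace.embedding (wE w))) ((matO γ₀).map ((FinitePlace.embedding (wE w)).comp σ)) m₁ m₂ ∧
      (∀ i j, normAbv (m₁ i j) ≤ Ms w) ∧ ∀ i j, normAbv (m₂ i j) ≤ Ms w)
    (hsupp_S : ∀ w ∈ S, w ∈ Sp → ∀ N γ, arith N γ → ∃ m₁ m₂,
      IsTranslateSplit (fun j i => FinitePlace.embedding (wE w) (f j i))
        (fun j i => FinitePlace.embedding (wE w) (σ (f j i)))
        ((matO γ).map (FinitePlace.embedding (wE w))) ((matO γ).map ((FinitePlace.embedding (wE w)).comp σ)) m₁ m₂ ∧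
      (∀ i j, normAbv (m₁ i j) ≤ Ms w) ∧ ∀ i j, normAbv (m₂ i j) ≤ Ms w)
    (hMcomp : ∀ w ∈ S, w ∈ Sp → Ms w ^ 6 / normAbv (FinitePlace.embedding (wE w) (d 0) *
      discSplit (fun i => FinitePlace.embedding (wE w) (d i)) (fun j i => FinitePlace.embedding (wE w) (f j i))
        (fun j i => FinitePlace.embedding (wE w) (σ (f j i))) 0) ≤ M w ^ 6) :
    SplitLocal (Ew wE) σ d f matO κF arith γ₀ S Sp M where
  hκF := hκF
  ψ₁ := fun w => FinitePlace.embedding (wE w)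
  ψ₂ := fun w => (FinitePlace.embedding (wE w)).comp σ
  abv := fun _ => normAbv
  hψ := fun _ _ _ => rfl
  habv := fun w hw x => apply_eq_normAbv_of_localDeg_eq_one wE hlies w (hsplit w hw) x
  hna := fun _ _ => isNonarchimedean_normAbv
  hf₁_int := hf₁_int
  hf₂_int := hf₂_int
  hd₁_int := hd₁_int
  hd₂_int := hd₂_int
  hdisc_unit := hdisc_unit
  hγ₀_int := hγ₀_int
  hsupp_int := hsupp_int
  Ms := Ms
  hMs := hMs
  hf₁_S := hf₁_S
  hf₂_S := hf₂_S
  hd₁_S := hd₁_S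
  hd₂_S := hd₂_S
  hγ₀_S := hγ₀_S
  hsupp_S := hsupp_S
  hMcomp := hMcomp

end package

end Summit.Ventures.HodgeRepro2.Tier7.Line3.AdicCompletionSplit
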